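import Summits.CriticalPhenomena.PercolationContinuityZ3.Theorems.PercNearOneGluingNoHeavyLowerTailKnQuestion8CoefficientwiseCoreClassKernelMixRegimeReduction
import HarnessLib

/-!
# The two cross flows of the increasing-event transfer (every graph, every up-set)

Support file (`--supports stmt-CriticalPhenomena-4575`, closed), prover `prim-cplus-coupling` (gen 41).  No definitions, no notations, no named facts,
no sorries; standard axioms.  Memo `prim-cplus-coupling/A5-COUPLING-gen41.md` §2.

CONJECTURE IET (gen 37 memo §2; cycle case = `Coefficientwise.iet_cycle`): for a finite multigraph (`ends`, edge set `E`), root `u`, observer `b`,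
EVERY up-closed event `𝒱`, all monotone `h, k` and monotone levels `0 ≤ hᵃ, hᵇ ≤ h`, `0 ≤ kᵃ, kᵇ ≤ k`:
  `IET(𝒱) := Σ_{ω ∈ 𝒱 : b ∈ X∖Y} h(X)k(X) + Σ_{ω ∈ 𝒱 : b ∈ Y∖X} (hᵃX − hᵇY)(kᵃX − kᵇY) ≥ 0`,  `X = C_u ω`, `Y = C_u(E∖ω)`.
THE TWO FLOWS.  At a demand point (`b ∈ Y∖X`) the anti-term is `(a − p̄)(c − q̄)` with `a = hᵃX`, `p̄ = hᵇY`, `c = kᵃX`, `q̄ = kᵇY`, and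
`(a − p̄)(c − q̄) ≥ −(a − p̄)⁺(q̄ − c)⁺ − (p̄ − a)⁺(c − q̄)⁺`.  The function `ω ↦ 1_𝒱 (hᵃX − hᵇY)⁺` is INCREASING (X grows, Y shrinks with ω),
`ω ↦ 1[b ∈ Y∖X] (kᵇY − kᵃX)⁺` is DECREASING and its complement-conjugate is `1[b ∈ X∖Y](kᵇX − kᵃY)⁺`; one two-colouring Harris inequality
(`sum_mul_sdiff_le_sum_mul`) therefore moves the whole first negative part onto the supply points:
  `Σ_{𝒱 ∩ {b∈Y∖X}} (hᵃX − hᵇY)⁺(kᵇY − kᵃX)⁺ ≤ Σ_{𝒱 ∩ {b∈X∖Y}} (hᵃX − hᵇY)⁺(kᵇX − kᵃY)⁺ =: Σ π₁`   (`Coefficientwise.iet_cross_flow`),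
and symmetrically the second one onto `Σ π₂`, `π₂ = (hᵇX − hᵃY)⁺(kᵃX − kᵇY)⁺`.  Since `π₁ ≤ hᵃX·kᵇX ≤ hk(X)` and `π₂ ≤ hᵇX·kᵃX ≤ hk(X)`, the supply
pays each flow separately but not always both:
* `Coefficientwise.iet_deficit_bound` — **`IET(𝒱) + Σ_{𝒱 ∩ {b∈X∖Y}} min(π₁, π₂) ≥ 0`** on every graph, for every up-set and all admissible levels;
* `Coefficientwise.iet_two_supply` — hence IET with the supply counted twice holds unconditionally;
* `Coefficientwise.iet_of_overlap_nonpos` — IET holds as soon as `min(π₁, π₂) ≤ 0` at every supply point of `𝒱`, in particular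
  (`iet_of_ha_zero`, `iet_of_hb_zero`, `iet_of_ka_zero`, `iet_of_kb_zero`) whenever one of the four levels vanishes identically (ONE-SIDED IET).
What is NOT here: the conjecture itself (both anti-diagonal types present with colliding landing sets needs the positive anti-terms; memo §2–§3).
[cite: KozmaNitzan2024, Questions 8–9 (§5.5 p. 36) (context: the Question-8 pocket covariance programme)]
-/

namespace Summit.CriticalPhenomena.PercolationContinuityZ3.Theorems

open Finset Literature.Probability.Percolation

namespace Coefficientwise

variable {ι V : Type*}

/-- Pointwise: `(a − p)(c − q) + (a − p)⁺(q − c)⁺ + (p − a)⁺(c − q)⁺ ≥ 0` (the two negative parts of a product of differences).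
[cite: KozmaNitzan2024, §5.5 (context only; elementary)] -/
theorem mul_sub_add_pos_parts_nonneg (a p c q : ℝ) :
    0 ≤ (a - p) * (c - q) + max (a - p) 0 * max (q - c) 0 + max (p - a) 0 * max (c - q) 0 := by
  rcases le_or_gt p a with hp | hp <;> rcases le_or_gt q c with hq | hq
  · rw [max_eq_left (sub_nonneg.mpr hp), max_eq_right (sub_nonpos.mpr hq), max_eq_right (sub_nonpos.mpr hp),
      max_eq_left (sub_nonneg.mpr hq)]
    nlinarith [mul_nonneg (sub_nonneg.mpr hp) (sub_nonneg.mpr hq)]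
  · rw [max_eq_left (sub_nonneg.mpr hp), max_eq_left (sub_nonneg.mpr hq.le), max_eq_right (sub_nonpos.mpr hp),
      max_eq_right (sub_nonpos.mpr hq.le)]
    nlinarith
  · rw [max_eq_right (sub_nonpos.mpr hp.le), max_eq_right (sub_nonpos.mpr hq), max_eq_left (sub_nonneg.mpr hp.le),
      max_eq_left (sub_nonneg.mpr hq)]
    nlinarith
  · rw [max_eq_right (sub_nonpos.mpr hp.le), max_eq_left (sub_nonneg.mpr hq.le), max_eq_left (sub_nonneg.mpr hp.le),
      max_eq_right (sub_nonpos.mpr hq.le)]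
    nlinarith [mul_nonneg (sub_nonneg.mpr hp.le) (sub_nonneg.mpr hq.le)]

open Classical in
/-- **The cross flow (every graph, every up-set).**  For monotone `p, q, r, s : Set V → ℝ` and an up-closed `𝒱`, with `X = C_u ω`,
`Y = C_u(E∖ω)`:  `Σ_{ω ∈ 𝒱, b ∈ Y∖X} (pX − qY)⁺ (rY − sX)⁺ ≤ Σ_{ω ∈ 𝒱, b ∈ X∖Y} (pX − qY)⁺ (rX − sY)⁺`.
Proof: `F = 1_𝒱 (pX − qY)⁺` and `G = 1[b ∈ X∖Y] (rX − sY)⁺` are monotone in `ω`, and `F(ω)G(E∖ω)` is the left summand; apply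
`sum_mul_sdiff_le_sum_mul` (two-colouring Harris).  With `(p,q,r,s) = (hᵃ,hᵇ,kᵇ,kᵃ)` resp. `(kᵃ,kᵇ,hᵇ,hᵃ)` these are the two flows of
the module docstring. [cite: KozmaNitzan2024, Questions 8–9 (§5.5 p. 36) (context); Harris 1960] -/
theorem iet_cross_flow (ends : ι → Sym2 V) (E : Finset ι) (u b : V)
    (𝒱 : Finset ι → Prop) (hV : ∀ ⦃s t : Finset ι⦄, s ⊆ t → 𝒱 s → 𝒱 t)
    (p q r s : Set V → ℝ) (mp : Monotone p) (mq : Monotone q) (mr : Monotone r) (ms : Monotone s) :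
    (∑ ω ∈ E.powerset, if 𝒱 ω ∧ b ∈ openCluster (ends '' (↑(E \ ω) : Set ι)) u ∧ b ∉ openCluster (ends '' (↑ω : Set ι)) u then
        max (p (openCluster (ends '' (↑ω : Set ι)) u) - q (openCluster (ends '' (↑(E \ ω) : Set ι)) u)) 0 *
          max (r (openCluster (ends '' (↑(E \ ω) : Set ι)) u) - s (openCluster (ends '' (↑ω : Set ι)) u)) 0 else 0)
    ≤ ∑ ω ∈ E.powerset, if 𝒱 ω ∧ b ∈ openCluster (ends '' (↑ω : Set ι)) u ∧ b ∉ openCluster (ends '' (↑(E \ ω) : Set ι)) u then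
        max (p (openCluster (ends '' (↑ω : Set ι)) u) - q (openCluster (ends '' (↑(E \ ω) : Set ι)) u)) 0 *
          max (r (openCluster (ends '' (↑ω : Set ι)) u) - s (openCluster (ends '' (↑(E \ ω) : Set ι)) u)) 0 else 0 := by
  set C : Finset ι → Set V := fun ω => openCluster (ends '' (↑ω : Set ι)) u with hC
  change (∑ ω ∈ E.powerset, if 𝒱 ω ∧ b ∈ C (E \ ω) ∧ b ∉ C ω then max (p (C ω) - q (C (E \ ω))) 0 * max (r (C (E \ ω)) - s (C ω)) 0 else 0)
    ≤ ∑ ω ∈ E.powerset, if 𝒱 ω ∧ b ∈ C ω ∧ b ∉ C (E \ ω) then max (p (C ω) - q (C (E \ ω))) 0 * max (r (C ω) - s (C (E \ ω))) 0 else 0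
  have hCmono : ∀ {ω ω' : Finset ι}, ω ⊆ ω' → C ω ⊆ C ω' := fun hle => openCluster_image_mono ends hle u
  set F : Finset ι → ℝ := fun ω => if 𝒱 ω then max (p (C ω) - q (C (E \ ω))) 0 else 0 with hF
  set G : Finset ι → ℝ := fun ω => if b ∈ C ω ∧ b ∉ C (E \ ω) then max (r (C ω) - s (C (E \ ω))) 0 else 0 with hG
  have mF : Monotone F := by
    intro x y hxy
    simp only [hF]
    have hdiff : C (E \ y) ⊆ C (E \ x) := hCmono (Finset.sdiff_subset_sdiff (le_refl E) hxy)
    by_cases hx : 𝒱 x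
    · rw [if_pos hx, if_pos (hV hxy hx)]
      exact max_le_max (sub_le_sub (mp (hCmono hxy)) (mq hdiff)) (le_refl 0)
    · rw [if_neg hx]
      by_cases hy : 𝒱 y
      · rw [if_pos hy]; exact le_max_right _ _
      · rw [if_neg hy]
  have mG : Monotone G := by
    intro x y hxy
    simp only [hG]
    have hdiff : C (E \ y) ⊆ C (E \ x) := hCmono (Finset.sdiff_subset_sdiff (le_refl E) hxy)
    by_cases hx : b ∈ C x ∧ b ∉ C (E \ x)
    · have hy : b ∈ C y ∧ b ∉ C (E \ y) := ⟨hCmono hxy hx.1, fun hb' => hx.2 (hdiff hb')⟩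
      rw [if_pos hx, if_pos hy]
      exact max_le_max (sub_le_sub (mr (hCmono hxy)) (ms hdiff)) (le_refl 0)
    · rw [if_neg hx]
      by_cases hy : b ∈ C y ∧ b ∉ C (E \ y)
      · rw [if_pos hy]; exact le_max_right _ _
      · rw [if_neg hy]
  have key := sum_mul_sdiff_le_sum_mul E F G mF mG
  have lhs : ∑ ω ∈ E.powerset, F ω * G (E \ ω)
      = ∑ ω ∈ E.powerset, (if 𝒱 ω ∧ b ∈ C (E \ ω) ∧ b ∉ C ω then max (p (C ω) - q (C (E \ ω))) 0 * max (r (C (E \ ω)) - s (C ω)) 0 else 0) := by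
    refine Finset.sum_congr rfl fun ω hω => ?_
    have hωE := Finset.mem_powerset.mp hω
    simp only [hF, hG]
    rw [Finset.sdiff_sdiff_eq_self hωE]
    by_cases hv : 𝒱 ω
    · by_cases hc : b ∈ C (E \ ω) ∧ b ∉ C ω
      · rw [if_pos hv, if_pos hc, if_pos ⟨hv, hc⟩]
      · rw [if_pos hv, if_neg hc, if_neg (fun h' => hc h'.2), mul_zero]
    · rw [if_neg hv, zero_mul, if_neg (fun h' => hv h'.1)]
  have rhs : ∑ ω ∈ E.powerset, F ω * G ω
      = ∑ ω ∈ E.powerset, (if 𝒱 ω ∧ b ∈ C ω ∧ b ∉ C (E \ ω) then max (p (C ω) - q (C (E \ ω))) 0 * max (r (C ω) - s (C (E \ ω))) 0 else 0) := by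
    refine Finset.sum_congr rfl fun ω _ => ?_
    simp only [hF, hG]
    by_cases hv : 𝒱 ω
    · by_cases hc : b ∈ C ω ∧ b ∉ C (E \ ω)
      · rw [if_pos hv, if_pos hc, if_pos ⟨hv, hc⟩]
      · rw [if_pos hv, if_neg hc, if_neg (fun h' => hc h'.2), mul_zero]
    · rw [if_neg hv, zero_mul, if_neg (fun h' => hv h'.1)]
  rw [lhs, rhs] at key
  exact key

open Classical in
/-- **IET up to the overlap of the two flows (every graph, every up-set).**  With `π₁ = (hᵃX − hᵇY)⁺(kᵇX − kᵃY)⁺` and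
`π₂ = (hᵇX − hᵃY)⁺(kᵃX − kᵇY)⁺` at the supply points (`b ∈ X∖Y`):
  `0 ≤ Σ_{𝒱, b∈X∖Y} h(X)k(X) + Σ_{𝒱, b∈Y∖X} (hᵃX − hᵇY)(kᵃX − kᵇY) + Σ_{𝒱, b∈X∖Y} min(π₁, π₂)`.
Proof: `mul_sub_add_pos_parts_nonneg` at every demand point, the two cross flows `iet_cross_flow`, and at a supply point
`hk − π₁ − π₂ + min(π₁,π₂) = hk − max(π₁,π₂) ≥ 0` because `π₁ ≤ hᵃX·kᵇX ≤ hk`, `π₂ ≤ hᵇX·kᵃX ≤ hk`.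
[cite: KozmaNitzan2024, Questions 8–9 (§5.5 p. 36) (context)] -/
theorem iet_deficit_bound (ends : ι → Sym2 V) (E : Finset ι) (u b : V)
    (𝒱 : Finset ι → Prop) (hV : ∀ ⦃s t : Finset ι⦄, s ⊆ t → 𝒱 s → 𝒱 t)
    (h k ha hb ka kb : Set V → ℝ)
    (mha : Monotone ha) (mhb : Monotone hb) (mka : Monotone ka) (mkb : Monotone kb)
    (ha0 : ∀ X, 0 ≤ ha X) (hah : ∀ X, ha X ≤ h X) (hb0 : ∀ X, 0 ≤ hb X) (hbh : ∀ X, hb X ≤ h X)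
    (ka0 : ∀ X, 0 ≤ ka X) (kak : ∀ X, ka X ≤ k X) (kb0 : ∀ X, 0 ≤ kb X) (kbk : ∀ X, kb X ≤ k X) :
    0 ≤ (∑ ω ∈ E.powerset, if 𝒱 ω ∧ b ∈ openCluster (ends '' (↑ω : Set ι)) u ∧ b ∉ openCluster (ends '' (↑(E \ ω) : Set ι)) u then
          h (openCluster (ends '' (↑ω : Set ι)) u) * k (openCluster (ends '' (↑ω : Set ι)) u) else 0)
        + (∑ ω ∈ E.powerset, if 𝒱 ω ∧ b ∈ openCluster (ends '' (↑(E \ ω) : Set ι)) u ∧ b ∉ openCluster (ends '' (↑ω : Set ι)) u then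
          (ha (openCluster (ends '' (↑ω : Set ι)) u) - hb (openCluster (ends '' (↑(E \ ω) : Set ι)) u)) *
            (ka (openCluster (ends '' (↑ω : Set ι)) u) - kb (openCluster (ends '' (↑(E \ ω) : Set ι)) u)) else 0)
        + ∑ ω ∈ E.powerset, if 𝒱 ω ∧ b ∈ openCluster (ends '' (↑ω : Set ι)) u ∧ b ∉ openCluster (ends '' (↑(E \ ω) : Set ι)) u then
          min (max (ha (openCluster (ends '' (↑ω : Set ι)) u) - hb (openCluster (ends '' (↑(E \ ω) : Set ι)) u)) 0 *
                max (kb (openCluster (ends '' (↑ω : Set ι)) u) - ka (openCluster (ends '' (↑(E \ ω) : Set ι)) u)) 0)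
              (max (hb (openCluster (ends '' (↑ω : Set ι)) u) - ha (openCluster (ends '' (↑(E \ ω) : Set ι)) u)) 0 *
                max (ka (openCluster (ends '' (↑ω : Set ι)) u) - kb (openCluster (ends '' (↑(E \ ω) : Set ι)) u)) 0) else 0 := by
  set C : Finset ι → Set V := fun ω => openCluster (ends '' (↑ω : Set ι)) u with hC
  change 0 ≤ (∑ ω ∈ E.powerset, if 𝒱 ω ∧ b ∈ C ω ∧ b ∉ C (E \ ω) then h (C ω) * k (C ω) else 0)
      + (∑ ω ∈ E.powerset, if 𝒱 ω ∧ b ∈ C (E \ ω) ∧ b ∉ C ω then (ha (C ω) - hb (C (E \ ω))) * (ka (C ω) - kb (C (E \ ω))) else 0)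
      + ∑ ω ∈ E.powerset, if 𝒱 ω ∧ b ∈ C ω ∧ b ∉ C (E \ ω) then
          min (max (ha (C ω) - hb (C (E \ ω))) 0 * max (kb (C ω) - ka (C (E \ ω))) 0)
              (max (hb (C ω) - ha (C (E \ ω))) 0 * max (ka (C ω) - kb (C (E \ ω))) 0) else 0
  -- the two flows
  have flow1 := iet_cross_flow ends E u b 𝒱 hV ha hb kb ka mha mhb mkb mka
  have flow2 := iet_cross_flow ends E u b 𝒱 hV ka kb hb ha mka mkb mhb mha
  change (∑ ω ∈ E.powerset, if 𝒱 ω ∧ b ∈ C (E \ ω) ∧ b ∉ C ω then max (ha (C ω) - hb (C (E \ ω))) 0 * max (kb (C (E \ ω)) - ka (C ω)) 0 else 0)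
    ≤ ∑ ω ∈ E.powerset, if 𝒱 ω ∧ b ∈ C ω ∧ b ∉ C (E \ ω) then max (ha (C ω) - hb (C (E \ ω))) 0 * max (kb (C ω) - ka (C (E \ ω))) 0 else 0
    at flow1
  change (∑ ω ∈ E.powerset, if 𝒱 ω ∧ b ∈ C (E \ ω) ∧ b ∉ C ω then max (ka (C ω) - kb (C (E \ ω))) 0 * max (hb (C (E \ ω)) - ha (C ω)) 0 else 0)
    ≤ ∑ ω ∈ E.powerset, if 𝒱 ω ∧ b ∈ C ω ∧ b ∉ C (E \ ω) then max (ka (C ω) - kb (C (E \ ω))) 0 * max (hb (C ω) - ha (C (E \ ω))) 0 else 0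
    at flow2
  -- demand points: T ≥ −(first negative part) − (second negative part)
  have hdem : ∀ ω ∈ E.powerset,
      -(if 𝒱 ω ∧ b ∈ C (E \ ω) ∧ b ∉ C ω then max (ha (C ω) - hb (C (E \ ω))) 0 * max (kb (C (E \ ω)) - ka (C ω)) 0 else 0)
      -(if 𝒱 ω ∧ b ∈ C (E \ ω) ∧ b ∉ C ω then max (ka (C ω) - kb (C (E \ ω))) 0 * max (hb (C (E \ ω)) - ha (C ω)) 0 else 0)
      ≤ (if 𝒱 ω ∧ b ∈ C (E \ ω) ∧ b ∉ C ω then (ha (C ω) - hb (C (E \ ω))) * (ka (C ω) - kb (C (E \ ω))) else 0) := by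
    intro ω _
    by_cases hc : 𝒱 ω ∧ b ∈ C (E \ ω) ∧ b ∉ C ω
    · simp only [if_pos hc]
      have := mul_sub_add_pos_parts_nonneg (ha (C ω)) (hb (C (E \ ω))) (ka (C ω)) (kb (C (E \ ω)))
      nlinarith [mul_comm (max (ka (C ω) - kb (C (E \ ω))) 0) (max (hb (C (E \ ω)) - ha (C ω)) 0)]
    · simp only [if_neg hc]; linarith
  -- supply points: hk − π₁ − π₂ + min(π₁, π₂) ≥ 0
  have hsup : ∀ ω ∈ E.powerset,
      (if 𝒱 ω ∧ b ∈ C ω ∧ b ∉ C (E \ ω) then max (ha (C ω) - hb (C (E \ ω))) 0 * max (kb (C ω) - ka (C (E \ ω))) 0 else 0)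
      + (if 𝒱 ω ∧ b ∈ C ω ∧ b ∉ C (E \ ω) then max (ka (C ω) - kb (C (E \ ω))) 0 * max (hb (C ω) - ha (C (E \ ω))) 0 else 0)
      ≤ (if 𝒱 ω ∧ b ∈ C ω ∧ b ∉ C (E \ ω) then h (C ω) * k (C ω) else 0)
        + (if 𝒱 ω ∧ b ∈ C ω ∧ b ∉ C (E \ ω) then
            min (max (ha (C ω) - hb (C (E \ ω))) 0 * max (kb (C ω) - ka (C (E \ ω))) 0)
                (max (hb (C ω) - ha (C (E \ ω))) 0 * max (ka (C ω) - kb (C (E \ ω))) 0) else 0) := by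
    intro ω _
    by_cases hc : 𝒱 ω ∧ b ∈ C ω ∧ b ∉ C (E \ ω)
    · simp only [if_pos hc]
      set X := C ω
      set Y := C (E \ ω)
      -- π₁ ≤ haX · kbX ≤ hX · kX and π₂ ≤ hbX · kaX ≤ hX · kX
      have e1 : max (ha X - hb Y) 0 ≤ h X := max_le (by linarith [hb0 Y, hah X]) (le_trans (ha0 X) (hah X))
      have e2 : max (kb X - ka Y) 0 ≤ k X := max_le (by linarith [ka0 Y, kbk X]) (le_trans (kb0 X) (kbk X))
      have e3 : max (hb X - ha Y) 0 ≤ h X := max_le (by linarith [ha0 Y, hbh X]) (le_trans (hb0 X) (hbh X))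
      have e4 : max (ka X - kb Y) 0 ≤ k X := max_le (by linarith [kb0 Y, kak X]) (le_trans (ka0 X) (kak X))
      have n1 : 0 ≤ max (ha X - hb Y) 0 := le_max_right _ _
      have n2 : 0 ≤ max (kb X - ka Y) 0 := le_max_right _ _
      have n3 : 0 ≤ max (hb X - ha Y) 0 := le_max_right _ _
      have n4 : 0 ≤ max (ka X - kb Y) 0 := le_max_right _ _
      have p1 : max (ha X - hb Y) 0 * max (kb X - ka Y) 0 ≤ h X * k X := mul_le_mul e1 e2 n2 (le_trans n1 e1)
      have p2 : max (hb X - ha Y) 0 * max (ka X - kb Y) 0 ≤ h X * k X := mul_le_mul e3 e4 n4 (le_trans n3 e3)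
      have p2' : max (ka X - kb Y) 0 * max (hb X - ha Y) 0 = max (hb X - ha Y) 0 * max (ka X - kb Y) 0 := mul_comm _ _
      rw [p2']
      rcases le_total (max (ha X - hb Y) 0 * max (kb X - ka Y) 0) (max (hb X - ha Y) 0 * max (ka X - kb Y) 0) with hle | hle
      · rw [min_eq_left hle]; linarith
      · rw [min_eq_right hle]; linarith
    · simp only [if_neg hc]; linarith
  have s1 := Finset.sum_le_sum hdem
  have s2 := Finset.sum_le_sum hsup
  rw [Finset.sum_sub_distrib, Finset.sum_neg_distrib] at s1
  rw [Finset.sum_add_distrib, Finset.sum_add_distrib] at s2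
  linarith

open Classical in
/-- **IET with the supply counted twice (every graph, every up-set).**
`0 ≤ Σ_{𝒱, b∈X∖Y} 2 h(X)k(X) + Σ_{𝒱, b∈Y∖X} (hᵃX − hᵇY)(kᵃX − kᵇY)`; from `iet_deficit_bound` and `min(π₁,π₂) ≤ π₁ ≤ hk`.
[cite: KozmaNitzan2024, Questions 8–9 (§5.5 p. 36) (context)] -/
theorem iet_two_supply (ends : ι → Sym2 V) (E : Finset ι) (u b : V)
    (𝒱 : Finset ι → Prop) (hV : ∀ ⦃s t : Finset ι⦄, s ⊆ t → 𝒱 s → 𝒱 t)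
    (h k ha hb ka kb : Set V → ℝ)
    (mha : Monotone ha) (mhb : Monotone hb) (mka : Monotone ka) (mkb : Monotone kb)
    (ha0 : ∀ X, 0 ≤ ha X) (hah : ∀ X, ha X ≤ h X) (hb0 : ∀ X, 0 ≤ hb X) (hbh : ∀ X, hb X ≤ h X)
    (ka0 : ∀ X, 0 ≤ ka X) (kak : ∀ X, ka X ≤ k X) (kb0 : ∀ X, 0 ≤ kb X) (kbk : ∀ X, kb X ≤ k X) :
    0 ≤ (∑ ω ∈ E.powerset, if 𝒱 ω ∧ b ∈ openCluster (ends '' (↑ω : Set ι)) u ∧ b ∉ openCluster (ends '' (↑(E \ ω) : Set ι)) u then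
          2 * (h (openCluster (ends '' (↑ω : Set ι)) u) * k (openCluster (ends '' (↑ω : Set ι)) u)) else 0)
        + ∑ ω ∈ E.powerset, if 𝒱 ω ∧ b ∈ openCluster (ends '' (↑(E \ ω) : Set ι)) u ∧ b ∉ openCluster (ends '' (↑ω : Set ι)) u then
          (ha (openCluster (ends '' (↑ω : Set ι)) u) - hb (openCluster (ends '' (↑(E \ ω) : Set ι)) u)) *
            (ka (openCluster (ends '' (↑ω : Set ι)) u) - kb (openCluster (ends '' (↑(E \ ω) : Set ι)) u)) else 0 := by
  set C : Finset ι → Set V := fun ω => openCluster (ends '' (↑ω : Set ι)) u with hC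
  have main := iet_deficit_bound ends E u b 𝒱 hV h k ha hb ka kb mha mhb mka mkb ha0 hah hb0 hbh ka0 kak kb0 kbk
  change 0 ≤ (∑ ω ∈ E.powerset, if 𝒱 ω ∧ b ∈ C ω ∧ b ∉ C (E \ ω) then h (C ω) * k (C ω) else 0)
      + (∑ ω ∈ E.powerset, if 𝒱 ω ∧ b ∈ C (E \ ω) ∧ b ∉ C ω then (ha (C ω) - hb (C (E \ ω))) * (ka (C ω) - kb (C (E \ ω))) else 0)
      + ∑ ω ∈ E.powerset, if 𝒱 ω ∧ b ∈ C ω ∧ b ∉ C (E \ ω) then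
          min (max (ha (C ω) - hb (C (E \ ω))) 0 * max (kb (C ω) - ka (C (E \ ω))) 0)
              (max (hb (C ω) - ha (C (E \ ω))) 0 * max (ka (C ω) - kb (C (E \ ω))) 0) else 0 at main
  change 0 ≤ (∑ ω ∈ E.powerset, if 𝒱 ω ∧ b ∈ C ω ∧ b ∉ C (E \ ω) then 2 * (h (C ω) * k (C ω)) else 0)
      + ∑ ω ∈ E.powerset, if 𝒱 ω ∧ b ∈ C (E \ ω) ∧ b ∉ C ω then (ha (C ω) - hb (C (E \ ω))) * (ka (C ω) - kb (C (E \ ω))) else 0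
  have hmin : ∀ ω ∈ E.powerset,
      (if 𝒱 ω ∧ b ∈ C ω ∧ b ∉ C (E \ ω) then
          min (max (ha (C ω) - hb (C (E \ ω))) 0 * max (kb (C ω) - ka (C (E \ ω))) 0)
              (max (hb (C ω) - ha (C (E \ ω))) 0 * max (ka (C ω) - kb (C (E \ ω))) 0) else 0)
        + (if 𝒱 ω ∧ b ∈ C ω ∧ b ∉ C (E \ ω) then h (C ω) * k (C ω) else 0)
      ≤ (if 𝒱 ω ∧ b ∈ C ω ∧ b ∉ C (E \ ω) then 2 * (h (C ω) * k (C ω)) else 0) := by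
    intro ω _
    by_cases hc : 𝒱 ω ∧ b ∈ C ω ∧ b ∉ C (E \ ω)
    · simp only [if_pos hc]
      set X := C ω
      set Y := C (E \ ω)
      have e1 : max (ha X - hb Y) 0 ≤ h X := max_le (by linarith [hb0 Y, hah X]) (le_trans (ha0 X) (hah X))
      have e2 : max (kb X - ka Y) 0 ≤ k X := max_le (by linarith [ka0 Y, kbk X]) (le_trans (kb0 X) (kbk X))
      have n1 : 0 ≤ max (ha X - hb Y) 0 := le_max_right _ _
      have n2 : 0 ≤ max (kb X - ka Y) 0 := le_max_right _ _
      have p1 : max (ha X - hb Y) 0 * max (kb X - ka Y) 0 ≤ h X * k X := mul_le_mul e1 e2 n2 (le_trans n1 e1)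
      have := min_le_left (max (ha X - hb Y) 0 * max (kb X - ka Y) 0) (max (hb X - ha Y) 0 * max (ka X - kb Y) 0)
      linarith
    · simp only [if_neg hc]; linarith
  have s3 := Finset.sum_le_sum hmin
  rw [Finset.sum_add_distrib] at s3
  linarith

open Classical in
/-- **IET when the two flows do not overlap.**  If at every supply point of `𝒱` one of the four factors `(hᵃX − hᵇY)⁺`, `(kᵇX − kᵃY)⁺`,
`(hᵇX − hᵃY)⁺`, `(kᵃX − kᵇY)⁺` vanishes — stated as `min(π₁, π₂) ≤ 0` — then the increasing-event transfer inequality holds for `𝒱`.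
[cite: KozmaNitzan2024, Questions 8–9 (§5.5 p. 36) (context)] -/
theorem iet_of_overlap_nonpos (ends : ι → Sym2 V) (E : Finset ι) (u b : V)
    (𝒱 : Finset ι → Prop) (hV : ∀ ⦃s t : Finset ι⦄, s ⊆ t → 𝒱 s → 𝒱 t)
    (h k ha hb ka kb : Set V → ℝ)
    (mha : Monotone ha) (mhb : Monotone hb) (mka : Monotone ka) (mkb : Monotone kb)
    (ha0 : ∀ X, 0 ≤ ha X) (hah : ∀ X, ha X ≤ h X) (hb0 : ∀ X, 0 ≤ hb X) (hbh : ∀ X, hb X ≤ h X)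
    (ka0 : ∀ X, 0 ≤ ka X) (kak : ∀ X, ka X ≤ k X) (kb0 : ∀ X, 0 ≤ kb X) (kbk : ∀ X, kb X ≤ k X)
    (hov : ∀ ω ∈ E.powerset, 𝒱 ω → b ∈ openCluster (ends '' (↑ω : Set ι)) u → b ∉ openCluster (ends '' (↑(E \ ω) : Set ι)) u →
      min (max (ha (openCluster (ends '' (↑ω : Set ι)) u) - hb (openCluster (ends '' (↑(E \ ω) : Set ι)) u)) 0 *
            max (kb (openCluster (ends '' (↑ω : Set ι)) u) - ka (openCluster (ends '' (↑(E \ ω) : Set ι)) u)) 0)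
          (max (hb (openCluster (ends '' (↑ω : Set ι)) u) - ha (openCluster (ends '' (↑(E \ ω) : Set ι)) u)) 0 *
            max (ka (openCluster (ends '' (↑ω : Set ι)) u) - kb (openCluster (ends '' (↑(E \ ω) : Set ι)) u)) 0) ≤ 0) :
    0 ≤ (∑ ω ∈ E.powerset, if 𝒱 ω ∧ b ∈ openCluster (ends '' (↑ω : Set ι)) u ∧ b ∉ openCluster (ends '' (↑(E \ ω) : Set ι)) u then
          h (openCluster (ends '' (↑ω : Set ι)) u) * k (openCluster (ends '' (↑ω : Set ι)) u) else 0)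
        + ∑ ω ∈ E.powerset, if 𝒱 ω ∧ b ∈ openCluster (ends '' (↑(E \ ω) : Set ι)) u ∧ b ∉ openCluster (ends '' (↑ω : Set ι)) u then
          (ha (openCluster (ends '' (↑ω : Set ι)) u) - hb (openCluster (ends '' (↑(E \ ω) : Set ι)) u)) *
            (ka (openCluster (ends '' (↑ω : Set ι)) u) - kb (openCluster (ends '' (↑(E \ ω) : Set ι)) u)) else 0 := by
  set C : Finset ι → Set V := fun ω => openCluster (ends '' (↑ω : Set ι)) u with hC
  have main := iet_deficit_bound ends E u b 𝒱 hV h k ha hb ka kb mha mhb mka mkb ha0 hah hb0 hbh ka0 kak kb0 kbk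
  change 0 ≤ (∑ ω ∈ E.powerset, if 𝒱 ω ∧ b ∈ C ω ∧ b ∉ C (E \ ω) then h (C ω) * k (C ω) else 0)
      + (∑ ω ∈ E.powerset, if 𝒱 ω ∧ b ∈ C (E \ ω) ∧ b ∉ C ω then (ha (C ω) - hb (C (E \ ω))) * (ka (C ω) - kb (C (E \ ω))) else 0)
      + ∑ ω ∈ E.powerset, if 𝒱 ω ∧ b ∈ C ω ∧ b ∉ C (E \ ω) then
          min (max (ha (C ω) - hb (C (E \ ω))) 0 * max (kb (C ω) - ka (C (E \ ω))) 0)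
              (max (hb (C ω) - ha (C (E \ ω))) 0 * max (ka (C ω) - kb (C (E \ ω))) 0) else 0 at main
  change ∀ ω ∈ E.powerset, 𝒱 ω → b ∈ C ω → b ∉ C (E \ ω) →
      min (max (ha (C ω) - hb (C (E \ ω))) 0 * max (kb (C ω) - ka (C (E \ ω))) 0)
          (max (hb (C ω) - ha (C (E \ ω))) 0 * max (ka (C ω) - kb (C (E \ ω))) 0) ≤ 0 at hov
  change 0 ≤ (∑ ω ∈ E.powerset, if 𝒱 ω ∧ b ∈ C ω ∧ b ∉ C (E \ ω) then h (C ω) * k (C ω) else 0)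
      + ∑ ω ∈ E.powerset, if 𝒱 ω ∧ b ∈ C (E \ ω) ∧ b ∉ C ω then (ha (C ω) - hb (C (E \ ω))) * (ka (C ω) - kb (C (E \ ω))) else 0
  have hle : ∑ ω ∈ E.powerset, (if 𝒱 ω ∧ b ∈ C ω ∧ b ∉ C (E \ ω) then
          min (max (ha (C ω) - hb (C (E \ ω))) 0 * max (kb (C ω) - ka (C (E \ ω))) 0)
              (max (hb (C ω) - ha (C (E \ ω))) 0 * max (ka (C ω) - kb (C (E \ ω))) 0) else 0) ≤ 0 := by
    refine Finset.sum_nonpos fun ω hω => ?_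
    by_cases hc : 𝒱 ω ∧ b ∈ C ω ∧ b ∉ C (E \ ω)
    · rw [if_pos hc]; exact hov ω hω hc.1 hc.2.1 hc.2.2
    · rw [if_neg hc]
  linarith

open Classical in
/-- **ONE-SIDED IET (every graph, every up-set): the case `hᵇ ≡ 0`.**  Then `π₂ = (0·X − hᵃY)⁺(…) = 0` at every supply point, so the
flows do not overlap and IET holds. [cite: KozmaNitzan2024, Questions 8–9 (§5.5 p. 36) (context)] -/
theorem iet_of_hb_zero (ends : ι → Sym2 V) (E : Finset ι) (u b : V)
    (𝒱 : Finset ι → Prop) (hV : ∀ ⦃s t : Finset ι⦄, s ⊆ t → 𝒱 s → 𝒱 t)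
    (h k ha hb ka kb : Set V → ℝ)
    (mha : Monotone ha) (mhb : Monotone hb) (mka : Monotone ka) (mkb : Monotone kb)
    (ha0 : ∀ X, 0 ≤ ha X) (hah : ∀ X, ha X ≤ h X) (hb0 : ∀ X, 0 ≤ hb X) (hbh : ∀ X, hb X ≤ h X)
    (ka0 : ∀ X, 0 ≤ ka X) (kak : ∀ X, ka X ≤ k X) (kb0 : ∀ X, 0 ≤ kb X) (kbk : ∀ X, kb X ≤ k X)
    (hbz : ∀ X, hb X = 0) :
    0 ≤ (∑ ω ∈ E.powerset, if 𝒱 ω ∧ b ∈ openCluster (ends '' (↑ω : Set ι)) u ∧ b ∉ openCluster (ends '' (↑(E \ ω) : Set ι)) u then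
          h (openCluster (ends '' (↑ω : Set ι)) u) * k (openCluster (ends '' (↑ω : Set ι)) u) else 0)
        + ∑ ω ∈ E.powerset, if 𝒱 ω ∧ b ∈ openCluster (ends '' (↑(E \ ω) : Set ι)) u ∧ b ∉ openCluster (ends '' (↑ω : Set ι)) u then
          (ha (openCluster (ends '' (↑ω : Set ι)) u) - hb (openCluster (ends '' (↑(E \ ω) : Set ι)) u)) *
            (ka (openCluster (ends '' (↑ω : Set ι)) u) - kb (openCluster (ends '' (↑(E \ ω) : Set ι)) u)) else 0 := by
  refine iet_of_overlap_nonpos ends E u b 𝒱 hV h k ha hb ka kb mha mhb mka mkb ha0 hah hb0 hbh ka0 kak kb0 kbk ?_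
  intro ω _ _ _ _
  have e : max (hb (openCluster (ends '' (↑ω : Set ι)) u) - ha (openCluster (ends '' (↑(E \ ω) : Set ι)) u)) 0 = 0 :=
    max_eq_right (by rw [hbz]; linarith [ha0 (openCluster (ends '' (↑(E \ ω) : Set ι)) u)])
  rw [e, zero_mul]
  exact min_le_right _ _

open Classical in
/-- **ONE-SIDED IET: the case `hᵃ ≡ 0`** (then `π₁ = 0` at every supply point). [cite: KozmaNitzan2024, Questions 8–9 (§5.5 p. 36) (context)] -/
theorem iet_of_ha_zero (ends : ι → Sym2 V) (E : Finset ι) (u b : V)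
    (𝒱 : Finset ι → Prop) (hV : ∀ ⦃s t : Finset ι⦄, s ⊆ t → 𝒱 s → 𝒱 t)
    (h k ha hb ka kb : Set V → ℝ)
    (mha : Monotone ha) (mhb : Monotone hb) (mka : Monotone ka) (mkb : Monotone kb)
    (ha0 : ∀ X, 0 ≤ ha X) (hah : ∀ X, ha X ≤ h X) (hb0 : ∀ X, 0 ≤ hb X) (hbh : ∀ X, hb X ≤ h X)
    (ka0 : ∀ X, 0 ≤ ka X) (kak : ∀ X, ka X ≤ k X) (kb0 : ∀ X, 0 ≤ kb X) (kbk : ∀ X, kb X ≤ k X)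
    (haz : ∀ X, ha X = 0) :
    0 ≤ (∑ ω ∈ E.powerset, if 𝒱 ω ∧ b ∈ openCluster (ends '' (↑ω : Set ι)) u ∧ b ∉ openCluster (ends '' (↑(E \ ω) : Set ι)) u then
          h (openCluster (ends '' (↑ω : Set ι)) u) * k (openCluster (ends '' (↑ω : Set ι)) u) else 0)
        + ∑ ω ∈ E.powerset, if 𝒱 ω ∧ b ∈ openCluster (ends '' (↑(E \ ω) : Set ι)) u ∧ b ∉ openCluster (ends '' (↑ω : Set ι)) u then
          (ha (openCluster (ends '' (↑ω : Set ι)) u) - hb (openCluster (ends '' (↑(E \ ω) : Set ι)) u)) *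
            (ka (openCluster (ends '' (↑ω : Set ι)) u) - kb (openCluster (ends '' (↑(E \ ω) : Set ι)) u)) else 0 := by
  refine iet_of_overlap_nonpos ends E u b 𝒱 hV h k ha hb ka kb mha mhb mka mkb ha0 hah hb0 hbh ka0 kak kb0 kbk ?_
  intro ω _ _ _ _
  have e : max (ha (openCluster (ends '' (↑ω : Set ι)) u) - hb (openCluster (ends '' (↑(E \ ω) : Set ι)) u)) 0 = 0 :=
    max_eq_right (by rw [haz]; linarith [hb0 (openCluster (ends '' (↑(E \ ω) : Set ι)) u)])
  rw [e, zero_mul]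
  exact min_le_left _ _

open Classical in
/-- **ONE-SIDED IET: the case `kᵇ ≡ 0`** (then `π₁ = 0` at every supply point). [cite: KozmaNitzan2024, Questions 8–9 (§5.5 p. 36) (context)] -/
theorem iet_of_kb_zero (ends : ι → Sym2 V) (E : Finset ι) (u b : V)
    (𝒱 : Finset ι → Prop) (hV : ∀ ⦃s t : Finset ι⦄, s ⊆ t → 𝒱 s → 𝒱 t)
    (h k ha hb ka kb : Set V → ℝ)
    (mha : Monotone ha) (mhb : Monotone hb) (mka : Monotone ka) (mkb : Monotone kb)
    (ha0 : ∀ X, 0 ≤ ha X) (hah : ∀ X, ha X ≤ h X) (hb0 : ∀ X, 0 ≤ hb X) (hbh : ∀ X, hb X ≤ h X)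
    (ka0 : ∀ X, 0 ≤ ka X) (kak : ∀ X, ka X ≤ k X) (kb0 : ∀ X, 0 ≤ kb X) (kbk : ∀ X, kb X ≤ k X)
    (kbz : ∀ X, kb X = 0) :
    0 ≤ (∑ ω ∈ E.powerset, if 𝒱 ω ∧ b ∈ openCluster (ends '' (↑ω : Set ι)) u ∧ b ∉ openCluster (ends '' (↑(E \ ω) : Set ι)) u then
          h (openCluster (ends '' (↑ω : Set ι)) u) * k (openCluster (ends '' (↑ω : Set ι)) u) else 0)
        + ∑ ω ∈ E.powerset, if 𝒱 ω ∧ b ∈ openCluster (ends '' (↑(E \ ω) : Set ι)) u ∧ b ∉ openCluster (ends '' (↑ω : Set ι)) u then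
          (ha (openCluster (ends '' (↑ω : Set ι)) u) - hb (openCluster (ends '' (↑(E \ ω) : Set ι)) u)) *
            (ka (openCluster (ends '' (↑ω : Set ι)) u) - kb (openCluster (ends '' (↑(E \ ω) : Set ι)) u)) else 0 := by
  refine iet_of_overlap_nonpos ends E u b 𝒱 hV h k ha hb ka kb mha mhb mka mkb ha0 hah hb0 hbh ka0 kak kb0 kbk ?_
  intro ω _ _ _ _
  have e : max (kb (openCluster (ends '' (↑ω : Set ι)) u) - ka (openCluster (ends '' (↑(E \ ω) : Set ι)) u)) 0 = 0 :=
    max_eq_right (by rw [kbz]; linarith [ka0 (openCluster (ends '' (↑(E \ ω) : Set ι)) u)])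
  rw [e, mul_zero]
  exact min_le_left _ _

open Classical in
/-- **ONE-SIDED IET: the case `kᵃ ≡ 0`** (then `π₂ = 0` at every supply point). [cite: KozmaNitzan2024, Questions 8–9 (§5.5 p. 36) (context)] -/
theorem iet_of_ka_zero (ends : ι → Sym2 V) (E : Finset ι) (u b : V)
    (𝒱 : Finset ι → Prop) (hV : ∀ ⦃s t : Finset ι⦄, s ⊆ t → 𝒱 s → 𝒱 t)
    (h k ha hb ka kb : Set V → ℝ)
    (mha : Monotone ha) (mhb : Monotone hb) (mka : Monotone ka) (mkb : Monotone kb)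
    (ha0 : ∀ X, 0 ≤ ha X) (hah : ∀ X, ha X ≤ h X) (hb0 : ∀ X, 0 ≤ hb X) (hbh : ∀ X, hb X ≤ h X)
    (ka0 : ∀ X, 0 ≤ ka X) (kak : ∀ X, ka X ≤ k X) (kb0 : ∀ X, 0 ≤ kb X) (kbk : ∀ X, kb X ≤ k X)
    (kaz : ∀ X, ka X = 0) :
    0 ≤ (∑ ω ∈ E.powerset, if 𝒱 ω ∧ b ∈ openCluster (ends '' (↑ω : Set ι)) u ∧ b ∉ openCluster (ends '' (↑(E \ ω) : Set ι)) u then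
          h (openCluster (ends '' (↑ω : Set ι)) u) * k (openCluster (ends '' (↑ω : Set ι)) u) else 0)
        + ∑ ω ∈ E.powerset, if 𝒱 ω ∧ b ∈ openCluster (ends '' (↑(E \ ω) : Set ι)) u ∧ b ∉ openCluster (ends '' (↑ω : Set ι)) u then
          (ha (openCluster (ends '' (↑ω : Set ι)) u) - hb (openCluster (ends '' (↑(E \ ω) : Set ι)) u)) *
            (ka (openCluster (ends '' (↑ω : Set ι)) u) - kb (openCluster (ends '' (↑(E \ ω) : Set ι)) u)) else 0 := by
  refine iet_of_overlap_nonpos ends E u b 𝒱 hV h k ha hb ka kb mha mhb mka mkb ha0 hah hb0 hbh ka0 kak kb0 kbk ?_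
  intro ω _ _ _ _
  have e : max (ka (openCluster (ends '' (↑ω : Set ι)) u) - kb (openCluster (ends '' (↑(E \ ω) : Set ι)) u)) 0 = 0 :=
    max_eq_right (by rw [kaz]; linarith [kb0 (openCluster (ends '' (↑(E \ ω) : Set ι)) u)])
  rw [e, mul_zero]
  exact min_le_right _ _

end Coefficientwise

end Summit.CriticalPhenomena.PercolationContinuityZ3.Theorems
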